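import Summits.Ventures.PercRepro2.CaseOneRootsAndMark
import Summits.Ventures.PercRepro2.CaseOneRootsOnlyI

/-!
# The single-edge Bernstein reduction: `(ii)` / `(i)` for every weight vector from the interior
Bernstein coefficients in one edge
(blind cell PercRepro2, p1 g17; S5 (S5.a″) (n), P1-FACE.md §8: the candidate (C-BERN1))

For a weight vector `p` and an edge `e`, `t ↦ iiExpr (p[e ↦ t])` is a cubic (every mass is affine in
`t`); its Bernstein coefficients `B₀ = iiExpr (p[e ↦ 0])` and `B₃ = iiExpr (p[e ↦ 1])` are INSTANCES with
one more decided edge, and the conjecture (C-BERN1) says the interior pair `B₁, B₂` is nonnegative. This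
file is the reduction: **if for every admissible `p` and every undecided edge `e` the interior pair is
nonnegative, then `(ii)` holds for every admissible `p`** (`zSplitII_of_bern1`), by induction on the
number of undecided edges — at a decided weight vector every probability is the indicator of one
configuration and the cleared forms vanish (`iiExpr_eq_zero_of_decided`), and the Bernstein face lemma
(`nonneg_of_bern3_faces` of `CaseOneGlued`, re-proved here to keep this file on the tree) closes the
step. Likewise `(i)` (`zSplitI_of_bern1`). Definitions: `Undecided p = {e | p e ≠ 0 ∧ p e ≠ 1}`,
`Bern1II p e B₁ B₂` = the Bernstein identity of `t ↦ iiExpr (p[e ↦ t])` with the two faces. Own code;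
standard axioms. -/

namespace Summit.Ventures.PercRepro2

namespace CaseOne

/-! ## A decided weight vector: one configuration carries all the mass -/

section Decided
variable {E : Type*} [Fintype E] [DecidableEq E] {R : Type*} [CommRing R]

open Classical in
/-- The configuration picked out by a decided weight vector. -/
noncomputable def decidedCfg (p : E → R) : Config E := fun e => decide (p e = 1)

omit [Fintype E] [DecidableEq E] in
/-- `decidedCfg p e = true` iff `p e = 1`. -/
lemma decidedCfg_eq_true_iff (p : E → R) (e : E) : decidedCfg p e = true ↔ p e = 1 := by
  simp [decidedCfg]

omit [Fintype E] [DecidableEq E] in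
/-- `decidedCfg p e = false` iff `p e ≠ 1`. -/
lemma decidedCfg_eq_false_iff (p : E → R) (e : E) : decidedCfg p e = false ↔ p e ≠ 1 := by
  simp [decidedCfg]

omit [DecidableEq E] in
/-- At a decided weight vector the weight of the configuration `decidedCfg p` is `1`. -/
lemma weight_decidedCfg (p : E → R) (hdec : ∀ e, p e = 0 ∨ p e = 1) : weight p (decidedCfg p) = 1 := by
  unfold weight
  refine Finset.prod_eq_one fun e _ => ?_
  by_cases h1 : p e = 1
  · rw [(decidedCfg_eq_true_iff p e).2 h1, edgeFactor_true, h1]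
  · have h0 : p e = 0 := (hdec e).resolve_right h1
    rw [(decidedCfg_eq_false_iff p e).2 h1, edgeFactor_false, h0, sub_zero]

/-- At a decided weight vector every other configuration has weight `0`. -/
lemma weight_eq_zero_of_ne_decidedCfg (p : E → R) (hdec : ∀ e, p e = 0 ∨ p e = 1) {ω : Config E}
    (hω : ω ≠ decidedCfg p) : weight p ω = 0 := by
  obtain ⟨e, he⟩ : ∃ e, ω e ≠ decidedCfg p e := by
    by_contra h
    exact hω (funext fun e => by_contra fun hne => h ⟨e, hne⟩)
  rw [weight_eq_mul_edgeFactor p ω e]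
  by_cases h1 : p e = 1
  · rw [(decidedCfg_eq_true_iff p e).2 h1] at he
    have : ω e = false := by
      cases hω' : ω e
      · rfl
      · exact absurd hω' he
    rw [this, edgeFactor_false, h1, sub_self, mul_zero]
  · have h0 : p e = 0 := (hdec e).resolve_right h1
    rw [(decidedCfg_eq_false_iff p e).2 h1] at he
    have : ω e = true := by
      cases hω' : ω e
      · exact absurd hω' he
      · rfl
    rw [this, edgeFactor_true, h0, mul_zero]

/-- At a decided weight vector the probability of an event is its indicator at `decidedCfg p`. -/
lemma prob_eq_indicator_of_decided (p : E → R) (hdec : ∀ e, p e = 0 ∨ p e = 1) (A : Set (Config E)) :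
    prob p A = A.indicator 1 (decidedCfg p) := by
  classical
  unfold prob
  rw [Finset.sum_eq_single (decidedCfg p)]
  · by_cases h : decidedCfg p ∈ A
    · rw [Set.indicator_of_mem h, Set.indicator_of_mem h, weight_decidedCfg p hdec]; rfl
    · rw [Set.indicator_of_notMem h, Set.indicator_of_notMem h]
  · intro ω _ hω
    by_cases h : ω ∈ A
    · rw [Set.indicator_of_mem h, weight_eq_zero_of_ne_decidedCfg p hdec hω]
    · rw [Set.indicator_of_notMem h]
  · intro h; exact absurd (Finset.mem_univ _) h

/-- At a decided weight vector probabilities multiply over intersections. -/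
lemma prob_inter_of_decided (p : E → R) (hdec : ∀ e, p e = 0 ∨ p e = 1) (A B : Set (Config E)) :
    prob p (A ∩ B) = prob p A * prob p B := by
  classical
  rw [prob_eq_indicator_of_decided p hdec, prob_eq_indicator_of_decided p hdec,
    prob_eq_indicator_of_decided p hdec]
  by_cases hA : decidedCfg p ∈ A <;> by_cases hB : decidedCfg p ∈ B <;> simp [hA, hB]

end Decided

section DecidedForms
variable {V : Type*} {E : Type*} [Fintype E] [DecidableEq E] {R : Type*} [CommRing R]
variable {ends : E → Sym2 V}

/-- **At a decided weight vector `iiExprT` vanishes** (every threshold pair). -/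
theorem iiExprT_eq_zero_of_decided (p : E → R) (hdec : ∀ e, p e = 0 ∨ p e = 1) (o a₁ a₂ a₃ b : V)
    (c₀ c₁ : R) : iiExprT p ends o a₁ a₂ a₃ b c₀ c₁ = 0 := by
  rw [iiExprT_eq]
  simp only [prob_inter_of_decided p hdec]
  ring

/-- **At a decided weight vector `iExprT` vanishes** (every threshold pair). -/
theorem iExprT_eq_zero_of_decided (p : E → R) (hdec : ∀ e, p e = 0 ∨ p e = 1) (o a₁ a₂ a₃ b : V)
    (c₀ c₁ : R) : iExprT p ends o a₁ a₂ a₃ b c₀ c₁ = 0 := by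
  rw [iExprT_eq]
  simp only [prob_inter_of_decided p hdec]
  ring

/-- **At a decided weight vector `iiExpr` vanishes.** -/
theorem iiExpr_eq_zero_of_decided (p : E → R) (hdec : ∀ e, p e = 0 ∨ p e = 1) (o a₁ a₂ a₃ b : V) :
    iiExpr p ends o a₁ a₂ a₃ b = 0 := by
  rw [iiExpr_eq_iiExprT, iiExprT_eq_zero_of_decided p hdec]

/-- **At a decided weight vector `iExpr` vanishes.** -/
theorem iExpr_eq_zero_of_decided (p : E → R) (hdec : ∀ e, p e = 0 ∨ p e = 1) (o a₁ a₂ a₃ b : V) :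
    iExpr p ends o a₁ a₂ a₃ b = 0 := by
  rw [iExpr_eq_iExprT, iExprT_eq_zero_of_decided p hdec]

end DecidedForms

/-! ## The single-edge Bernstein hypothesis and the reduction -/

section Bern1
variable {V : Type*} {E : Type*} [Fintype E] [DecidableEq E] {R : Type*} [Field R] [LinearOrder R]
  [IsStrictOrderedRing R]
variable {ends : E → Sym2 V}

/-- The undecided edges of a weight vector. -/
def undecided (p : E → R) : Finset E := Finset.univ.filter fun e => p e ≠ 0 ∧ p e ≠ 1

/-- Deciding an edge removes it from the undecided set (and adds none). -/
lemma undecided_update (p : E → R) (e : E) (c : R) (hc : c = 0 ∨ c = 1) :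
    undecided (Function.update p e c) = (undecided p).erase e := by
  ext e'
  simp only [undecided, Finset.mem_filter, Finset.mem_univ, true_and, Finset.mem_erase, ne_eq]
  by_cases h : e' = e
  · subst h
    simp only [Function.update_self, not_true_eq_false, false_and, iff_false]
    rcases hc with hc | hc <;> simp [hc]
  · rw [Function.update_of_ne h]; tauto

/-- **The Bernstein face lemma** (the version with both faces). -/
theorem nonneg_of_bern3_faces' (f : R → R) (B₀ B₁ B₂ B₃ : R)
    (hf : ∀ t, f t = (1 - t) ^ 3 * B₀ + 3 * (t * (1 - t) ^ 2) * B₁ + 3 * (t ^ 2 * (1 - t)) * B₂ +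
      t ^ 3 * B₃)
    (h0 : 0 ≤ f 0) (h1 : 0 ≤ B₁) (h2 : 0 ≤ B₂) (h3 : 0 ≤ f 1) {t : R} (ht0 : 0 ≤ t) (ht1 : t ≤ 1) :
    0 ≤ f t := by
  have hB0 : B₀ = f 0 := by rw [hf 0]; ring
  have hB3 : B₃ = f 1 := by rw [hf 1]; ring
  have hB0' : 0 ≤ B₀ := hB0 ▸ h0
  have hB3' : 0 ≤ B₃ := hB3 ▸ h3
  rw [hf t]
  have h1t : 0 ≤ 1 - t := sub_nonneg.2 ht1
  have h3' : (0 : R) ≤ 3 := by norm_num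
  exact add_nonneg (add_nonneg (add_nonneg (mul_nonneg (pow_nonneg h1t 3) hB0')
    (mul_nonneg (mul_nonneg h3' (mul_nonneg ht0 (pow_nonneg h1t 2))) h1))
    (mul_nonneg (mul_nonneg h3' (mul_nonneg (pow_nonneg ht0 2) h1t)) h2))
    (mul_nonneg (pow_nonneg ht0 3) hB3')

/-- **(C-BERN1) for `(ii)` at `(p, e)`**: the cubic `t ↦ iiExpr (p[e ↦ t])` has nonnegative interior
Bernstein coefficients (its face coefficients are the instances `p[e ↦ 0]`, `p[e ↦ 1]`). -/
def Bern1II (p : E → R) (ends : E → Sym2 V) (o a₁ a₂ a₃ b : V) (e : E) : Prop :=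
  ∃ B₁ B₂ : R, 0 ≤ B₁ ∧ 0 ≤ B₂ ∧ ∀ t : R,
    iiExpr (Function.update p e t) ends o a₁ a₂ a₃ b =
      (1 - t) ^ 3 * iiExpr (Function.update p e 0) ends o a₁ a₂ a₃ b +
        3 * (t * (1 - t) ^ 2) * B₁ + 3 * (t ^ 2 * (1 - t)) * B₂ +
        t ^ 3 * iiExpr (Function.update p e 1) ends o a₁ a₂ a₃ b

/-- **(C-BERN1) for `(i)` at `(p, e)`.** -/
def Bern1I (p : E → R) (ends : E → Sym2 V) (o a₁ a₂ a₃ b : V) (e : E) : Prop :=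
  ∃ B₁ B₂ : R, 0 ≤ B₁ ∧ 0 ≤ B₂ ∧ ∀ t : R,
    iExpr (Function.update p e t) ends o a₁ a₂ a₃ b =
      (1 - t) ^ 3 * iExpr (Function.update p e 0) ends o a₁ a₂ a₃ b +
        3 * (t * (1 - t) ^ 2) * B₁ + 3 * (t ^ 2 * (1 - t)) * B₂ +
        t ^ 3 * iExpr (Function.update p e 1) ends o a₁ a₂ a₃ b

/-- **The single-edge Bernstein reduction for `(ii)`**: if (C-BERN1) holds at every admissible weight
vector and every undecided edge, then `(ii)` holds at every admissible weight vector. -/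
theorem zSplitII_of_bern1 (o a₁ a₂ a₃ b : V)
    (H : ∀ p : E → R, IsProbVec p → ∀ e ∈ undecided p, Bern1II p ends o a₁ a₂ a₃ b e)
    (p : E → R) (hp : IsProbVec p) : ZSplitII p ends o a₁ a₂ a₃ b := by
  generalize hn : (undecided p).card = n
  induction n using Nat.strong_induction_on generalizing p with
  | _ n ih =>
    by_cases h0 : undecided p = ∅
    · have hdec : ∀ e, p e = 0 ∨ p e = 1 := by
        intro e
        by_contra hc
        have : e ∈ undecided p := by
          simp only [undecided, Finset.mem_filter, Finset.mem_univ, true_and, ne_eq]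
          exact ⟨fun h => hc (Or.inl h), fun h => hc (Or.inr h)⟩
        rw [h0] at this
        exact absurd this (Finset.notMem_empty e)
      unfold ZSplitII
      rw [iiExpr_eq_zero_of_decided p hdec]
    · obtain ⟨e, he⟩ := Finset.nonempty_iff_ne_empty.mpr h0
      obtain ⟨B₁, B₂, hB₁, hB₂, hf⟩ := H p hp e he
      have hlt : ((undecided p).erase e).card < n := by
        rw [← hn]; exact Finset.card_erase_lt_of_mem he
      have hp0 : IsProbVec (Function.update p e 0) := hp.update e le_rfl zero_le_one
      have hp1 : IsProbVec (Function.update p e 1) := hp.update e zero_le_one le_rfl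
      have h0' := ih _ hlt (Function.update p e 0) hp0 (by rw [undecided_update p e 0 (Or.inl rfl)])
      have h1' := ih _ hlt (Function.update p e 1) hp1 (by rw [undecided_update p e 1 (Or.inr rfl)])
      unfold ZSplitII at h0' h1' ⊢
      have hself : Function.update p e (p e) = p := Function.update_eq_self e p
      rw [← hself]
      exact nonneg_of_bern3_faces' (fun t => iiExpr (Function.update p e t) ends o a₁ a₂ a₃ b)
        _ B₁ B₂ _ hf h0' hB₁ hB₂ h1' (hp.nonneg e) (hp.le_one e)

/-- **The single-edge Bernstein reduction for `(i)`.** -/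
theorem zSplitI_of_bern1 (o a₁ a₂ a₃ b : V)
    (H : ∀ p : E → R, IsProbVec p → ∀ e ∈ undecided p, Bern1I p ends o a₁ a₂ a₃ b e)
    (p : E → R) (hp : IsProbVec p) : ZSplitI p ends o a₁ a₂ a₃ b := by
  generalize hn : (undecided p).card = n
  induction n using Nat.strong_induction_on generalizing p with
  | _ n ih =>
    by_cases h0 : undecided p = ∅
    · have hdec : ∀ e, p e = 0 ∨ p e = 1 := by
        intro e
        by_contra hc
        have : e ∈ undecided p := by
          simp only [undecided, Finset.mem_filter, Finset.mem_univ, true_and, ne_eq]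
          exact ⟨fun h => hc (Or.inl h), fun h => hc (Or.inr h)⟩
        rw [h0] at this
        exact absurd this (Finset.notMem_empty e)
      unfold ZSplitI
      rw [iExpr_eq_zero_of_decided p hdec]
    · obtain ⟨e, he⟩ := Finset.nonempty_iff_ne_empty.mpr h0
      obtain ⟨B₁, B₂, hB₁, hB₂, hf⟩ := H p hp e he
      have hlt : ((undecided p).erase e).card < n := by
        rw [← hn]; exact Finset.card_erase_lt_of_mem he
      have hp0 : IsProbVec (Function.update p e 0) := hp.update e le_rfl zero_le_one
      have hp1 : IsProbVec (Function.update p e 1) := hp.update e zero_le_one le_rfl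
      have h0' := ih _ hlt (Function.update p e 0) hp0 (by rw [undecided_update p e 0 (Or.inl rfl)])
      have h1' := ih _ hlt (Function.update p e 1) hp1 (by rw [undecided_update p e 1 (Or.inr rfl)])
      unfold ZSplitI at h0' h1' ⊢
      have hself : Function.update p e (p e) = p := Function.update_eq_self e p
      rw [← hself]
      exact nonneg_of_bern3_faces' (fun t => iExpr (Function.update p e t) ends o a₁ a₂ a₃ b)
        _ B₁ B₂ _ hf h0' hB₁ hB₂ h1' (hp.nonneg e) (hp.le_one e)

end Bern1

end CaseOne

end Summit.Ventures.PercRepro2
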